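import Summits.ResolutionOfSingularities.ResolutionOfSingularities.Theorems.EquisingularLiftEquisingularLiftNatTowerRoundBPrimeDefs
import HarnessLib

/-!
# T23-A″ «PAIR ROUNDS» (boundary-witnessed rounds) — DOWNSTAIRS DEFS (text owner res-L1-w45b-lead-2 g5, on the engine word of res-L1-w45b-stub-4 g11
# `L/res-L1-w45b-stub-4/T23Adprime-ENGINE-WORD.md` 16d03a46d50c8ccd §1): `RoundTransportOKDoublePrime` / `TowerRoundBDoublePrime` / `ReachTowerBDoublePrime` /
# `ReachNoseTowerBDoublePrime` + monotonicity `reachTowerBDoublePrime_of_reachTowerBPrime` / `reachNoseTowerBDoublePrime_of_reachNoseTowerBPrime`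

OURS · L1 W4.5(b) · EL♮(3) stmt-ResolutionOfSingularities-20148 (parent EL♮ stmt-…-20038) · counted 0 · AI-written planning vocabulary, weaker than expert review; nothing of
[Hironaka2017] asserted; NOT a statement of the manuscript. Definitions + pure-logic monotonicity only (no `sorry`, no instance, no notation; standard axioms).
`--kind definition --supports stmt-ResolutionOfSingularities-20148 --as helper`. Registration mode as T23-A′ (desk R15/R18): engine-green swap, rung targets″ =
`TARGET-DEF{TOWER,NOSETOWER}BPRIME-THREE.sig.txt` with `BPrime ↦ BDoublePrime`, residues `…nonDefTowerBDoublePrime` / `…nonDefNoseTowerBDoublePrime`.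

WHY. The first CONCRETE member of the typed isolated residue `stub_elnat_three_isolated_nonDefTowerBPrime` (texts of record CHILD v35 6807f8a43153aae2) is
`x⁴ + y⁶ + z⁶` (res-L1-w45b-lead-1 `ND-SPECIMEN-PASS-2.md` bd97ffa6ab4d5bd9, stub-4 l.79279): its E1-legal resolution blows up `σ₀ = E₁ ∩ St(E)`, a (−2)-curve on the
running surface against an OLDER exceptional — refused by every B′ round (Čech `H¹ ≠ 0`; no cone shadow along a retained member), although upstairs the centre is
TAUTOLOGICAL: the intersection of the two members' O-models. DESIGN (engine word §0–§1, minimal churn exactly as B′ was cut from B): the round step gains ONE binder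
`W` (the WITNESS member) and a THIRD hosting branch «PAIR ROUND»: `Hst, W ∈ E :: Es`, `Hst ≠ W`, `ConeWitness G Hst hH W Z hZ` (i.e. `Z = Hst ∩ W` set-theoretically —
`W` is closed, so `closure W = W` — and the REDUCED crossing `𝓘⟨Hst⟩ ⊔ 𝓘⟨W⟩ = 𝓘⟨Z⟩`), `Z̃` regular, `E' = υ₂⁻¹Z`, cone-shadow menu as printed below; in the two old
branches `W = Hst`. The transport rule gains the alternative `F = W` (the witness is a CO-HOST: `St_𝒞 V(𝓦) ≅ V(𝓦)`). NOT in the branch, deliberately (engine word §1):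
`DirStepSec`, `DirStepUnobs`, G-regularity along `Z`, two-sided non-tangency — the upstairs regularity/flatness of `𝓗 ⊔ 𝓦` comes from the codimension of `Z̃` at
CLOSED crossing points, which the engine derives from `TowerFull`. `ReachTowerBDoublePrime` / `ReachNoseTowerBDoublePrime` = the B′ closures over the new round step,
seed list STILL `[]` (the seed widening (A″-S) — the point plane `St(E_x)` as a retained member with reduced trace — is an inner-engine item, engine word §S; the
customer `x⁴+y⁶+z⁶` falls inside only when both are registered; this cut already admits every pair centre `E_new ∩ St(E_old)` born AFTER a round). Monotonicity
(pure logic, proved): a B′-chain is a B″-chain (`W := Hst`; `RoundTransportOKPrime → RoundTransportOKDoublePrime` inserts the unused alternative) ⇒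
`ReachTowerBPrime → ReachTowerBDoublePrime`, `ReachNoseTowerBPrime → ReachNoseTowerBDoublePrime`.
-/

set_option linter.dupNamespace false

noncomputable section

open CategoryTheory CategoryTheory.Limits AlgebraicGeometry TopologicalSpace Topology IsLocalRing
open Literature.AlgebraicGeometry.Resolution
open AlgebraicGeometry.Scheme.IdealSheafData

namespace Summit.ResolutionOfSingularities.ResolutionOfSingularities.Cruxes.EquisingularLiftNat.Sections

/-- **Admissible transport of a retained member `F` at a ROUND with centre `Z`, host `Hst` and witness `W` — T23-A″ form**: `RoundTransportOKPrime` (host /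
disjoint / transversally crossed, stalkwise (T1) ∧ (T2)) plus the CO-HOST alternative `F = W` (at a pair round the witness contains `Z` and its strict transform is
isomorphic to it); in all cases `F' = closure υ₂⁻¹(F ∖ Z)`. In the two old hosting branches `W = Hst`, so the new alternative is idle there. [OURS · T23-A″ Defs] -/
def RoundTransportOKDoublePrime {G G' : Scheme.{0}} (υ₂ : G' ⟶ G) (Z : Set G) (hZ : IsClosed Z) (Hst W F : Set G) (F' : Set G') : Prop :=
  (F = Hst ∨ F = W ∨ Disjoint Z F ∨
      ∃ hF : IsClosed F,
        (∀ g ∈ Z ∩ F, stalkIdeal (vanishingIdeal (⟨Z, hZ⟩ : Closeds G)) g ⊔ stalkIdeal (vanishingIdeal (⟨F, hF⟩ : Closeds G)) g =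
            maximalIdeal (G.presheaf.stalk g)) ∧
          ∀ g ∈ Z ∩ F, stalkIdeal (vanishingIdeal (⟨Z, hZ⟩ : Closeds G)) g ≠ maximalIdeal (G.presheaf.stalk g)) ∧
    F' = closure (υ₂ ⁻¹' (F \ Z))

/-- B′ transports are B″ transports (same host, witness := host). [OURS · pure logic] -/
theorem roundTransportOKDoublePrime_of_roundTransportOKPrime {G G' : Scheme.{0}} {υ₂ : G' ⟶ G} {Z : Set G} {hZ : IsClosed Z} {Hst W F : Set G}
    {F' : Set G'} (h : RoundTransportOKPrime υ₂ Z hZ Hst F F') : RoundTransportOKDoublePrime υ₂ Z hZ Hst W F F' :=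
  ⟨h.1.elim Or.inl (fun h' => Or.inr (Or.inr h')), h.2⟩

/-- **TOWER-B″ / (round)** — `TowerRoundBPrime` with ONE new binder `W` (the WITNESS; `W = Hst` in the two old hosting branches, VERBATIM otherwise) and a THIRD
branch, the PAIR ROUND (T23-A″, engine word res-L1-w45b-stub-4 g11 `T23Adprime-ENGINE-WORD.md` 16d03a46d50c8ccd §1): the centre is the REDUCED crossing curve
`Z = Hst ∩ W` of two distinct retained members (`ConeWitness G Hst hH W Z hZ`: `Z = Hst ∩ closure W` and `𝓘⟨Hst⟩ ⊔ 𝓘⟨closure W⟩ = 𝓘⟨Z⟩`), with `Z̃` regular, full over the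
carrier; upstairs the centre is TAUTOLOGICAL (`𝓗 ⊔ 𝓦`, no (T-k), no `DirStepUnobs`); `E' = υ₂⁻¹Z`; cone-shadow menu as printed; members transported by
`RoundTransportOKDoublePrime` (the witness is a co-host: alternative `F = W`). [OURS · Defs of the T23-A″ registration] -/
def TowerRoundBDoublePrime (F₉ F₁₀ : Scheme.{0}) (υ' : F₁₀ ⟶ F₉) (Z₉ : Set F₉) (hZ₉ : IsClosed Z₉)
    (R : ∀ G : Scheme.{0}, (G ⟶ F₁₀) → Set G → Set G → List (Set G) → Set G → Prop) : Prop :=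
  ∀ (G G' : Scheme.{0}) (γ : G ⟶ F₁₀) (T E : Set G) (Es : List (Set G)) (K : Set G) (hE : IsClosed E) (Z : Set G) (hZ : IsClosed Z)
      (Hst W : Set G) (υ₂ : G' ⟶ G) (K' : Set G') (E' : Set G') (Es' : List (Set G')),
    R G γ T E Es K →
    Z ⊆ T → Z.Nonempty →
    TowerFull F₉ F₁₀ υ' Z₉ hZ₉ G γ Z hZ →
    ((W = Hst ∧ Hst = E ∧ Z ⊆ E ∧
        ((DirStepSec F₉ F₁₀ υ' Z₉ hZ₉ G γ Z hZ ∧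
            ((RationalCarrier (redSub F₉ Z₉ hZ₉) ∧
                (∀ x : redSub G Z hZ, IsRegularLocalRing (G.presheaf.stalk (redSubι G Z hZ x))) ∧
                (∀ (i : redSub G Z hZ ⟶ redSub G E hE), i ≫ redSubι G E hE = redSubι G Z hZ →
                  ∀ x : redSub G Z hZ, IsRegularLocalRing ((redSub G E hE).presheaf.stalk (i x))) ∧
                DirStepUnobs G E hE Z hZ) ∨
              ConeWitness G E hE K Z hZ)) ∨
          (IsIrreducible Z ∧ (∀ x : redSub G Z hZ, IsRegularLocalRing ((redSub G Z hZ).presheaf.stalk x)) ∧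
            (∀ x : redSub G Z hZ, IsRegularLocalRing (G.presheaf.stalk (redSubι G Z hZ x))) ∧
            (∀ (i : redSub G Z hZ ⟶ redSub G E hE), i ≫ redSubι G E hE = redSubι G Z hZ →
              ∀ x : redSub G Z hZ, IsRegularLocalRing ((redSub G E hE).presheaf.stalk (i x))) ∧
            DirStepUnobs G E hE Z hZ)) ∧
        (E' = υ₂ ⁻¹' Z ∨ E' = closure (υ₂ ⁻¹' (E \ Z))) ∧
        (K' = ∅ ∨ ((ConeWitness G E hE K Z hZ ∨ closure (Z \ closure K) = Z) ∧ K' = closure (υ₂ ⁻¹' (K \ Z))))) ∨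
      (W = Hst ∧ Hst ∈ Es ∧ ∃ hF : IsClosed Hst, Z ⊆ Hst ∧ IsIrreducible Z ∧
        (∀ x : redSub G Z hZ, IsRegularLocalRing ((redSub G Z hZ).presheaf.stalk x)) ∧
        (∀ x : redSub G Z hZ, IsRegularLocalRing (G.presheaf.stalk (redSubι G Z hZ x))) ∧
        (∀ (i : redSub G Z hZ ⟶ redSub G Hst hF), i ≫ redSubι G Hst hF = redSubι G Z hZ →
          ∀ x : redSub G Z hZ, IsRegularLocalRing ((redSub G Hst hF).presheaf.stalk (i x))) ∧
        DirStepUnobs G Hst hF Z hZ ∧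
        E' = υ₂ ⁻¹' Z ∧
        (K' = ∅ ∨ (Disjoint Z (closure K) ∧ K' = closure (υ₂ ⁻¹' (K \ Z))))) ∨
      -- NEW (T23-A″): the PAIR ROUND — centre = the reduced crossing curve of two retained members `Hst` (host) and `W` (witness)
      (Hst ∈ E :: Es ∧ W ∈ E :: Es ∧ Hst ≠ W ∧ ∃ (hH : IsClosed Hst) (_hW : IsClosed W),
        ConeWitness G Hst hH W Z hZ ∧
        (∀ x : redSub G Z hZ, IsRegularLocalRing ((redSub G Z hZ).presheaf.stalk x)) ∧
        E' = υ₂ ⁻¹' Z ∧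
        (K' = ∅ ∨ ((((Hst = E ∨ W = E) ∧ closure (Z \ closure K) = Z) ∨ Disjoint Z (closure K)) ∧
          K' = closure (υ₂ ⁻¹' (K \ Z)))))) →
    IsBlowup υ₂ (Scheme.IdealSheafData.vanishingIdeal (⟨Z, hZ⟩ : Closeds G)) →
    (∀ F' ∈ Es', ∃ F ∈ E :: Es, RoundTransportOKDoublePrime υ₂ Z hZ Hst W F F') →
    R G' (υ₂ ≫ γ) (closure (υ₂ ⁻¹' (T \ Z))) E' Es' K'

/-- Closure under the B″ round step implies closure under the B′ round step (the B′ step is the sub-case `W := Hst`). [OURS · pure logic] -/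
theorem towerRoundBPrime_of_towerRoundBDoublePrime (F₉ F₁₀ : Scheme.{0}) (υ' : F₁₀ ⟶ F₉) (Z₉ : Set F₉) (hZ₉ : IsClosed Z₉)
    (R : ∀ G : Scheme.{0}, (G ⟶ F₁₀) → Set G → Set G → List (Set G) → Set G → Prop)
    (h : TowerRoundBDoublePrime F₉ F₁₀ υ' Z₉ hZ₉ R) : TowerRoundBPrime F₉ F₁₀ υ' Z₉ hZ₉ R := by
  intro G G' γ T E Es K hE Z hZ Hst υ₂ K' E' Es' hR hZT hne hfull hadm hbl hlist
  refine h G G' γ T E Es K hE Z hZ Hst Hst υ₂ K' E' Es' hR hZT hne hfull ?_ hbl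
    (fun F' hF' => by
      obtain ⟨F, hF, hok⟩ := hlist F' hF'
      exact ⟨F, hF, roundTransportOKDoublePrime_of_roundTransportOKPrime hok⟩)
  rcases hadm with h1 | h2
  · exact Or.inl ⟨rfl, h1⟩
  · exact Or.inr (Or.inl ⟨rfl, h2⟩)

/-- **ReachTowerBDoublePrime** — `ReachTowerBPrime` with the round step `TowerRoundBDoublePrime` (pair rounds admitted); same prefix, same seed (list `[]` — the seed
widening (A″-S) of the engine word §S is NOT in this cut), same point steps. Downstairs only. [OURS · T23-A″ Defs] -/
def ReachTowerBDoublePrime (F₁ F₂ : Scheme.{0}) (υ : F₂ ⟶ F₁) (x : F₁) (T₂ : Set F₂) (F' : Scheme.{0}) (β : F' ⟶ F₂) (T' : Set F') : Prop :=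
  ∃ (W : Set F₁) (K₂ : Set F₂) (F₉ : Scheme.{0}) (β₉ : F₉ ⟶ F₂) (T₉ Z₉ K₉ : Set F₉) (b₉ : Bool) (hZ₉ : IsClosed Z₉)
    (F₁₀ : Scheme.{0}) (υ' : F₁₀ ⟶ F₉) (γ' : F' ⟶ F₁₀) (E' : Set F') (Es' : List (Set F')) (K' : Set F'),
    x ∈ W ∧ ¬ (υ ⁻¹' {x} ⊆ closure (υ ⁻¹' (W \ {x}))) ∧
    (∃ U : F₁.affineOpens, x ∈ (U : F₁.Opens) ∧
      ((Scheme.IdealSheafData.vanishingIdeal (⟨closure W, isClosed_closure⟩ : Closeds F₁)).ideal U).IsPrincipal) ∧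
    υ ⁻¹' {x} ∩ closure (υ ⁻¹' (W \ {x})) ⊆ T₂ ∧
    (K₂ = ∅ ∨ (ConeForm F₁ x W ∧ K₂ = closure (υ ⁻¹' (W \ {x})))) ∧
    InCarrierReachK F₂ T₂ (υ ⁻¹' {x} ∩ closure (υ ⁻¹' (W \ {x}))) K₂ F₉ β₉ T₉ Z₉ K₉ b₉ ∧
    Z₉ ⊆ T₉ ∧ ¬ (T₉ ⊆ Z₉) ∧ Z₉.Infinite ∧
    Set.Finite {z : redSub F₉ Z₉ hZ₉ | ¬ IsRegularLocalRing ((redSub F₉ Z₉ hZ₉).presheaf.stalk z)} ∧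
    IsBlowup υ' (Scheme.IdealSheafData.vanishingIdeal (⟨Z₉, hZ₉⟩ : Closeds F₉)) ∧
    (∀ R : (∀ G : Scheme.{0}, (G ⟶ F₁₀) → Set G → Set G → List (Set G) → Set G → Prop),
      R F₁₀ (𝟙 F₁₀) (closure (υ' ⁻¹' (T₉ \ Z₉))) (υ' ⁻¹' Z₉) [] (closure (υ' ⁻¹' (K₉ \ Z₉))) →
      TowerPtRegB F₉ F₁₀ υ' R → TowerPtRamB F₉ F₁₀ υ' R → TowerRoundBDoublePrime F₉ F₁₀ υ' Z₉ hZ₉ R → R F' γ' T' E' Es' K') ∧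
    β = (γ' ≫ υ') ≫ β₉

/-- **ReachNoseTowerBDoublePrime** — `ReachNoseTowerBPrime` with the round step `TowerRoundBDoublePrime` (seed list `[]`). Downstairs only. [OURS · T23-A″ Defs] -/
def ReachNoseTowerBDoublePrime (k : Type) [Field k] (n : ℕ) (H : Scheme.{0})
    (ι : H ⟶ (Literature.AlgebraicGeometry.Motives.projectiveSpace n k).left) : Prop :=
  ∃ (Z : Set (Literature.AlgebraicGeometry.Motives.projectiveSpace n k).left) (hZ : IsClosed Z),
    IsLiftableNoseClass₂ k n Z ∧ Z ⊆ Set.range ι ∧ ¬ (Set.range ι ⊆ Z) ∧ Z.Infinite ∧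
    (∀ z : ↥(redSub (Literature.AlgebraicGeometry.Motives.projectiveSpace n k).left Z hZ),
      IsClosed ({z} : Set ↥(redSub (Literature.AlgebraicGeometry.Motives.projectiveSpace n k).left Z hZ)) →
        ringKrullDim ((redSub (Literature.AlgebraicGeometry.Motives.projectiveSpace n k).left Z hZ).presheaf.stalk z) =
          ((1 : ℕ) : WithBot ℕ∞)) ∧
    ∃ (F₂ : Scheme.{0}) (υ : F₂ ⟶ (Literature.AlgebraicGeometry.Motives.projectiveSpace n k).left),
      IsBlowup υ (Scheme.IdealSheafData.vanishingIdeal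
        (⟨Z, hZ⟩ : Closeds (Literature.AlgebraicGeometry.Motives.projectiveSpace n k).left)) ∧
      ∃ (F' : Scheme.{0}) (γ' : F' ⟶ F₂) (T' E' : Set F') (Es' : List (Set F')) (K' : Set F'),
        (∀ R : (∀ G : Scheme.{0}, (G ⟶ F₂) → Set G → Set G → List (Set G) → Set G → Prop),
          R F₂ (𝟙 F₂) (closure (υ ⁻¹' (Set.range ι \ Z))) (υ ⁻¹' Z) [] ∅ →
          TowerPtRegB (Literature.AlgebraicGeometry.Motives.projectiveSpace n k).left F₂ υ R →
          TowerPtRamB (Literature.AlgebraicGeometry.Motives.projectiveSpace n k).left F₂ υ R →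
          TowerRoundBDoublePrime (Literature.AlgebraicGeometry.Motives.projectiveSpace n k).left F₂ υ Z hZ R →
          R F' γ' T' E' Es' K') ∧
        Literature.AlgebraicGeometry.Resolution.Scheme.IsRegular (redSub F' (closure T') isClosed_closure)

/-- **TOWER-B′ ⊆ TOWER-B″**: a B′-chain is a B″-chain. [OURS · pure logic] -/
theorem reachTowerBDoublePrime_of_reachTowerBPrime (F₁ F₂ : Scheme.{0}) (υ : F₂ ⟶ F₁) (x : F₁) (T₂ : Set F₂) (F' : Scheme.{0}) (β : F' ⟶ F₂)
    (T' : Set F') (h : ReachTowerBPrime F₁ F₂ υ x T₂ F' β T') : ReachTowerBDoublePrime F₁ F₂ υ x T₂ F' β T' := by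
  obtain ⟨W, K₂, F₉, β₉, T₉, Z₉, K₉, b₉, hZ₉, F₁₀, υ', γ', E', Es', K', h1, h2, h3, h4, h5, h6, h7, h8, h9, h10, h11, hcl, hβ⟩ := h
  refine ⟨W, K₂, F₉, β₉, T₉, Z₉, K₉, b₉, hZ₉, F₁₀, υ', γ', E', Es', K', h1, h2, h3, h4, h5, h6, h7, h8, h9, h10, h11, ?_, hβ⟩
  intro R hseed hreg hram hround
  exact hcl R hseed hreg hram (towerRoundBPrime_of_towerRoundBDoublePrime F₉ F₁₀ υ' Z₉ hZ₉ R hround)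

/-- **NOSE-B′ ⊆ NOSE-B″**. [OURS · pure logic] -/
theorem reachNoseTowerBDoublePrime_of_reachNoseTowerBPrime (k : Type) [Field k] (n : ℕ) (H : Scheme.{0})
    (ι : H ⟶ (Literature.AlgebraicGeometry.Motives.projectiveSpace n k).left) (h : ReachNoseTowerBPrime k n H ι) :
    ReachNoseTowerBDoublePrime k n H ι := by
  obtain ⟨Z, hZ, h1, h2, h3, h4, h5, F₂, υ, hυ, F', γ', T', E', Es', K', hcl, hreg⟩ := h
  refine ⟨Z, hZ, h1, h2, h3, h4, h5, F₂, υ, hυ, F', γ', T', E', Es', K', ?_, hreg⟩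
  intro R hseed hreg' hram hround
  exact hcl R hseed hreg' hram (towerRoundBPrime_of_towerRoundBDoublePrime _ F₂ υ Z hZ R hround)

end Summit.ResolutionOfSingularities.ResolutionOfSingularities.Cruxes.EquisingularLiftNat.Sections

end
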